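import Mathlib
import Literature.MathematicalPhysics.QuantumLattice.HeatKernelGroupCircleKernelProofs
import Summits.Ventures.LatticeQCDFlow.Scaling.U1TorusHaar

/-!
# LatticeQCDFlow / Scaling — `U(1)` layer words: the vertical Haar integral of a word of lateral
# plaquettes, and the girth of a torus layer (no closed word of length `≤ 3` for `L ≥ 4`)

HONEST FRAMING: exact (Metropolis-corrected) sampling algorithms for lattice gauge theory;
figures of merit are autocorrelation/cost numbers at stated couplings and volumes; no
continuum-physics claim.

Venture `LatticeQCDFlow` (cell pub-lqcd), topic `Scaling`, FANOUT row 30 (lean-1) — OUR WORK (LEAD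
LINE 230 (G3′)), the first lattice file of the slab-chain proof of (LC) at every separation: the
combinatorics that makes the abstract moment hypothesis of `Scaling/SlabKernel.lean` hold for
`U(1)` with `g = 4`.  Fix an axis `a` of the torus `(ℤ/L)^d`.  A LAYER is the set of sites with
`a`-coordinate `0` (`LSite`), its edges in directions `≠ a` are `LEdge` (source `src`, direction
`dir`, target `tgt = src + e_dir`).  The lateral plaquettes of a slab are in bijection with layer
edges `ℓ`, and the `U(1)` cosine of such a plaquette is `Re (v(src ℓ) e(ℓ) v(tgt ℓ)⁻¹ e'(ℓ)⁻¹)` with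
`v` the vertical bond variables of the slab and `e, e'` the horizontal bond variables of its two
layers.  Expanding a power of the slab cost produces SIGNED WORDS `(w : Fin m → LEdge, ε : Fin m →
Bool)`; this file computes their vertical Haar integral and proves the girth lemma:
* `boundaryCharge w ε y` — the net exponent of the vertical variable `v(y)` in the word;
  `vertFactor_eq_prod_zpow` — `∏_l (v(src w_l) v(tgt w_l)⁻¹)^{±1} = ∏_y v(y)^{charge(y)}`;
* `integral_coe_prod_zpow_pi` — `∫ ∏_y v(y)^{n(y)} dHaar^{⊗} = [n = 0]` (characters of a torus);
  hence `integral_vertFactor` — the vertical integral of a word is `1` if it is CLOSED (all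
  charges vanish) and `0` otherwise;
* **`wordChar_eq_one_of_closed`** (girth) — for `L ≥ 4`, a closed signed word of length `m ≤ 3`
  has trivial horizontal character `∏_l r(w_l)^{±1} = 1` for every `r` (its letters cancel in
  pairs): the displacement `Σ_l ± e_{dir w_l}` of a closed word vanishes in `(ℤ/L)^d`
  (`sum_sgn_single_eq_zero_of_closed`), so every direction is used an even number of times
  (`|Σ ±1| ≤ 3 < L`), `m` is even, and for `m = 2` closedness at the source forces the two letters
  to coincide with opposite signs.
Elementary; nothing is cited as a fact; `def`s `LSite`, `LEdge` (+ `src/dir/tgt`), `sgn`,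
`boundaryCharge`, `vertFactor`, `wordChar`; no `sorry`.
-/

noncomputable section

open MeasureTheory Filter Finset
open Literature.MathematicalPhysics.QuantumFieldTheory

namespace Summit.Ventures.LatticeQCDFlow.Theory2.Lattice.U1Layer

variable {d L : ℕ} {a : Fin d}

/-! ## 1. Layer sites and layer edges -/

/-- The layer of the torus `(ℤ/L)^d` through the origin orthogonal to the axis `a`: sites with
`a`-coordinate `0`. [folklore] -/
def LSite (d L : ℕ) (a : Fin d) : Type := {y : Site d L // y a = 0}

/-- The layer is finite. [folklore] -/
instance [NeZero L] : Fintype (LSite d L a) := inferInstanceAs (Fintype {y : Site d L // y a = 0})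

/-- The layer has decidable equality. [folklore] -/
instance : DecidableEq (LSite d L a) := inferInstanceAs (DecidableEq {y : Site d L // y a = 0})

/-- The edges of the layer: a layer site and a direction different from `a`. [folklore] -/
def LEdge (d L : ℕ) (a : Fin d) : Type := {e : LSite d L a × Fin d // e.2 ≠ a}

/-- The layer edges are finite. [folklore] -/
instance [NeZero L] : Fintype (LEdge d L a) :=
  inferInstanceAs (Fintype {e : LSite d L a × Fin d // e.2 ≠ a})

/-- The layer edges have decidable equality. [folklore] -/
instance : DecidableEq (LEdge d L a) :=
  inferInstanceAs (DecidableEq {e : LSite d L a × Fin d // e.2 ≠ a})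

namespace LEdge

/-- The source of a layer edge. [folklore] -/
def src (ℓ : LEdge d L a) : LSite d L a := ℓ.1.1

/-- The direction of a layer edge (`≠ a`). [folklore] -/
def dir (ℓ : LEdge d L a) : Fin d := ℓ.1.2

/-- The direction of a layer edge is not the axis. [folklore] -/
theorem dir_ne (ℓ : LEdge d L a) : ℓ.dir ≠ a := ℓ.2

/-- The target `src + e_dir` of a layer edge (again in the layer). [folklore] -/
def tgt (ℓ : LEdge d L a) : LSite d L a :=
  ⟨ℓ.1.1.1.shift ℓ.1.2, by
    have h1 : ℓ.1.1.1 a = 0 := ℓ.1.1.2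
    simp [Site.shift, ℓ.2.symm, h1]⟩

/-- The underlying site of the target. [folklore] -/
theorem tgt_val (ℓ : LEdge d L a) : (ℓ.tgt.1 : Site d L) = ℓ.src.1 + Pi.single ℓ.dir 1 := rfl

/-- Two layer edges with the same source and direction are equal. [folklore] -/
theorem ext_of_src_dir {ℓ ℓ' : LEdge d L a} (hs : ℓ.src = ℓ'.src) (hd : ℓ.dir = ℓ'.dir) : ℓ = ℓ' :=
  Subtype.ext (Prod.ext hs hd)

/-- On a torus of side `≥ 2` the target differs from the source. [folklore] -/
theorem tgt_ne_src [NeZero L] (hL : 2 ≤ L) (ℓ : LEdge d L a) : ℓ.tgt ≠ ℓ.src := by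
  intro h
  have h1 : (ℓ.tgt.1 : Site d L) ℓ.dir = ℓ.src.1 ℓ.dir := by rw [h]
  rw [tgt_val, Pi.add_apply, Pi.single_eq_same, add_eq_left] at h1
  have h2 : (1 : ZMod L).val = 0 := by rw [h1, ZMod.val_zero]
  rw [ZMod.val_one_eq_one_mod, Nat.mod_eq_of_lt (by omega)] at h2
  exact one_ne_zero h2

end LEdge

/-! ## 2. Signed words and their vertical factor -/

variable [NeZero L]

/-- The sign `±1` encoded by a Boolean. [folklore] -/
def sgn (b : Bool) : ℤ := if b then 1 else -1

/-- `sgn b = 1 ∨ sgn b = −1`. [folklore] -/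
theorem sgn_eq_or (b : Bool) : sgn b = 1 ∨ sgn b = -1 := by
  cases b <;> simp [sgn]

/-- `|sgn b| = 1`. [folklore] -/
theorem abs_sgn (b : Bool) : |sgn b| = 1 := by
  cases b <;> simp [sgn]

/-- `sgn b` is odd: `sgn b % 2 = 1` in the form `∃ k, sgn b = 2k + 1`. [folklore] -/
theorem sgn_eq_two_mul_add_one (b : Bool) : ∃ k : ℤ, sgn b = 2 * k + 1 := by
  cases b
  · exact ⟨-1, by simp [sgn]⟩
  · exact ⟨0, by simp [sgn]⟩

/-- **The boundary charge** of a signed word at a layer site: the net exponent of the vertical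
variable `v(y)` in `∏_l (v(src w_l) v(tgt w_l)⁻¹)^{sgn ε_l}`. [folklore] -/
def boundaryCharge {m : ℕ} (w : Fin m → LEdge d L a) (ε : Fin m → Bool) (y : LSite d L a) : ℤ :=
  ∑ l, sgn (ε l) * ((if (w l).src = y then 1 else 0) - (if (w l).tgt = y then 1 else 0))

/-- **The vertical factor** of a signed word: `∏_l (v(src w_l) · v(tgt w_l)⁻¹)^{sgn ε_l}`. [folklore] -/
def vertFactor {m : ℕ} (w : Fin m → LEdge d L a) (ε : Fin m → Bool) (v : LSite d L a → Circle) :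
    Circle :=
  ∏ l, (v (w l).src * (v (w l).tgt)⁻¹) ^ sgn (ε l)

/-- **The horizontal character** of a signed word: `∏_l r(w_l)^{sgn ε_l}`. [folklore] -/
def wordChar {m : ℕ} (w : Fin m → LEdge d L a) (ε : Fin m → Bool) (r : LEdge d L a → Circle) :
    Circle :=
  ∏ l, r (w l) ^ sgn (ε l)

/-- A single letter regrouped over the layer sites:
`(v s · (v t)⁻¹)^c = ∏_y v(y)^{c([s = y] − [t = y])}`. [folklore] -/
theorem letter_eq_prod_zpow (v : LSite d L a → Circle) (s t : LSite d L a) (c : ℤ) :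
    (v s * (v t)⁻¹) ^ c =
      ∏ y, v y ^ (c * ((if s = y then 1 else 0) - (if t = y then 1 else 0))) := by
  have key : ∀ u : LSite d L a, ∏ y, v y ^ (c * (if u = y then (1 : ℤ) else 0)) = v u ^ c := by
    intro u
    have h : ∀ y, v y ^ (c * (if u = y then (1 : ℤ) else 0)) = if u = y then v y ^ c else 1 := by
      intro y; split_ifs <;> simp
    simp_rw [h, Finset.prod_ite_eq, if_pos (mem_univ _)]
  rw [mul_zpow, inv_zpow]
  simp_rw [mul_sub, zpow_sub, Finset.prod_mul_distrib, Finset.prod_inv_distrib, key]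

/-- **Regrouping**: the vertical factor is `∏_y v(y)^{charge(y)}`. [folklore] -/
theorem vertFactor_eq_prod_zpow {m : ℕ} (w : Fin m → LEdge d L a) (ε : Fin m → Bool)
    (v : LSite d L a → Circle) : vertFactor w ε v = ∏ y, v y ^ boundaryCharge w ε y := by
  -- `g^{Σ f} = ∏ g^{f}` (the integer-power analogue of `Finset.prod_pow_eq_pow_sum`)
  have hz : ∀ (g : Circle) (f : Fin m → ℤ), g ^ (∑ l, f l) = ∏ l, g ^ f l := by
    intro g f
    induction (univ : Finset (Fin m)) using Finset.induction_on with
    | empty => simp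
    | insert i s hi ih => rw [sum_insert hi, prod_insert hi, zpow_add, ih]
  unfold vertFactor boundaryCharge
  simp_rw [hz, letter_eq_prod_zpow]
  exact Finset.prod_comm

/-! ## 3. Haar integrals of torus characters -/

/-- **Characters of a finite torus**: `∫ ∏_y v(y)^{n(y)} dHaar^{⊗} = [n = 0]`. [folklore] -/
theorem integral_coe_prod_zpow_pi {ι : Type*} [Fintype ι] [DecidableEq ι] (nn : ι → ℤ) :
    ∫ v, ((∏ y, v y ^ nn y : Circle) : ℂ) ∂(Measure.pi fun _ : ι => haarProbability Circle) =
      if nn = 0 then 1 else 0 := by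
  have hcoe : ∀ v : ι → Circle, ((∏ y, v y ^ nn y : Circle) : ℂ) = ∏ y, ((v y : ℂ) ^ nn y) := by
    intro v
    rw [← Circle.coeHom_apply, map_prod]
    simp
  simp_rw [hcoe]
  rw [integral_fintype_prod_eq_prod (fun y (z : Circle) => (z : ℂ) ^ nn y)]
  simp_rw [Literature.MathematicalPhysics.QuantumLattice.integral_coe_zpow_haarProbability_circle]
  rw [Fintype.prod_boole]
  congr 1
  simp [funext_iff]

/-- **The vertical integral of a signed word**: `1` if the word is closed, `0` otherwise. [folklore] -/
theorem integral_vertFactor {m : ℕ} (w : Fin m → LEdge d L a) (ε : Fin m → Bool) :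
    ∫ v, ((vertFactor w ε v : Circle) : ℂ) ∂(Measure.pi fun _ : LSite d L a => haarProbability Circle) =
      if boundaryCharge w ε = 0 then 1 else 0 := by
  simp_rw [vertFactor_eq_prod_zpow]
  exact integral_coe_prod_zpow_pi _

/-! ## 4. The girth of a layer: closed words of length `≤ 3` are trivial -/

section Girth

variable {m : ℕ} (w : Fin m → LEdge d L a) (ε : Fin m → Bool)

/-- **Displacement of a closed word.**  Summing `charge(y) • y` over the layer telescopes each
letter to `∓ e_{dir}`: a closed word has `Σ_l sgn ε_l • e_{dir w_l} = 0` in `(ℤ/L)^d`. [folklore] -/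
theorem sum_sgn_single_eq_zero_of_closed (hcl : boundaryCharge w ε = 0) :
    (∑ l, sgn (ε l) • (Pi.single (w l).dir (1 : ZMod L) : Site d L)) = 0 := by
  -- `Σ_y charge(y) • y = Σ_l sgn ε_l • (src − tgt) = −Σ_l sgn ε_l • e_dir`
  have hsum : ∑ y : LSite d L a, boundaryCharge w ε y • (y.1 : Site d L) =
      -∑ l, sgn (ε l) • (Pi.single (w l).dir (1 : ZMod L) : Site d L) := by
    unfold boundaryCharge
    simp_rw [Finset.sum_smul]
    rw [Finset.sum_comm]
    rw [← Finset.sum_neg_distrib]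
    refine sum_congr rfl fun l _ => ?_
    simp_rw [mul_smul]
    rw [← Finset.smul_sum]
    simp_rw [sub_smul, Finset.sum_sub_distrib, ite_smul, one_smul, zero_smul, Finset.sum_ite_eq,
      if_pos (mem_univ _)]
    rw [LEdge.tgt_val]
    simp
  rw [hcl] at hsum
  simp only [Pi.zero_apply, zero_smul, sum_const_zero] at hsum
  exact neg_eq_zero.1 hsum.symm

/-- The signed count of the letters in direction `b` of a closed word vanishes (as an integer),
provided the word is shorter than the torus: `m < L`. [folklore] -/
theorem sum_sgn_fiber_eq_zero_of_closed (hmL : m < L) (hcl : boundaryCharge w ε = 0)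
    (b : Fin d) : ∑ l ∈ univ.filter (fun l => (w l).dir = b), sgn (ε l) = 0 := by
  have h := congrFun (sum_sgn_single_eq_zero_of_closed w ε hcl) b
  simp only [Finset.sum_apply, Pi.smul_apply, Pi.single_apply, smul_ite, smul_zero,
    Pi.zero_apply, Finset.sum_ite, sum_const_zero, add_zero] at h
  -- `h : Σ_{l : dir = b} sgn ε_l • 1 = 0` in `ZMod L`
  have hcast : ((∑ l ∈ univ.filter (fun l => (w l).dir = b), sgn (ε l) : ℤ) : ZMod L) = 0 := by
    have hflt : univ.filter (fun l : Fin m => (w l).dir = b) = univ.filter (fun l => b = (w l).dir) :=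
      Finset.filter_congr fun l _ => eq_comm
    rw [hflt]
    push_cast
    simpa [zsmul_eq_mul] using h
  rw [ZMod.intCast_zmod_eq_zero_iff_dvd] at hcast
  refine Int.eq_zero_of_abs_lt_dvd hcast ?_
  calc |∑ l ∈ univ.filter (fun l => (w l).dir = b), sgn (ε l)|
      ≤ ∑ l ∈ univ.filter (fun l => (w l).dir = b), |sgn (ε l)| := abs_sum_le_sum_abs _ _
    _ = ((univ.filter (fun l => (w l).dir = b)).card : ℤ) := by simp [abs_sgn]
    _ ≤ (m : ℤ) := by exact_mod_cast (card_filter_le _ _).trans (by simp)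
    _ < L := by exact_mod_cast hmL

/-- A sum of `±1` over a finite set vanishes only if the set has even cardinality. [folklore] -/
theorem even_card_of_sum_sgn_eq_zero (s : Finset (Fin m)) (h : ∑ l ∈ s, sgn (ε l) = 0) :
    Even s.card := by
  have hmod : ∀ l, ∃ k : ℤ, sgn (ε l) = 2 * k + 1 := fun l => sgn_eq_two_mul_add_one (ε l)
  choose k hk using hmod
  have hs : ∑ l ∈ s, sgn (ε l) = 2 * ∑ l ∈ s, k l + s.card := by
    simp_rw [hk, sum_add_distrib, mul_sum, sum_const, nsmul_eq_mul, mul_one]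
  rw [hs] at h
  have h2 : (2 : ℤ) ∣ (s.card : ℤ) := ⟨-∑ l ∈ s, k l, by linarith⟩
  exact Int.natCast_dvd_natCast.1 h2 |> fun h => even_iff_two_dvd.2 h

/-- **A closed word shorter than the torus has even length.** [folklore] -/
theorem even_of_closed (hmL : m < L) (hcl : boundaryCharge w ε = 0) : Even m := by
  classical
  have hfib := Finset.card_eq_sum_card_fiberwise (s := (univ : Finset (Fin m))) (t := univ)
    (f := fun l => (w l).dir) fun _ _ => mem_univ _
  rw [card_univ, Fintype.card_fin] at hfib
  rw [hfib]
  refine Finset.even_sum _ fun b _ => ?_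
  exact even_card_of_sum_sgn_eq_zero ε _ (sum_sgn_fiber_eq_zero_of_closed w ε hmL hcl b)

end Girth

/-- **A closed word of length two is a letter and its inverse.** [folklore] -/
theorem eq_and_ne_of_closed_two (hL : 3 ≤ L) (w : Fin 2 → LEdge d L a)
    (ε : Fin 2 → Bool) (hcl : boundaryCharge w ε = 0) : w 1 = w 0 ∧ ε 1 ≠ ε 0 := by
  -- same direction and opposite signs
  have hb := sum_sgn_fiber_eq_zero_of_closed w ε (by omega) hcl (w 0).dir
  have hdir : (w 1).dir = (w 0).dir := by
    by_contra hne
    have hset : univ.filter (fun l : Fin 2 => (w l).dir = (w 0).dir) = {0} := by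
      ext l; fin_cases l <;> simp [hne]
    rw [hset, sum_singleton] at hb
    rcases sgn_eq_or (ε 0) with h | h <;> rw [h] at hb <;> norm_num at hb
  have hset : univ.filter (fun l : Fin 2 => (w l).dir = (w 0).dir) = univ := by
    ext l; fin_cases l <;> simp [hdir]
  rw [hset, Fin.sum_univ_two] at hb
  have hε : ε 1 ≠ ε 0 := by
    intro h
    rw [h] at hb
    rcases sgn_eq_or (ε 0) with h' | h' <;> rw [h'] at hb <;> norm_num at hb
  have hsgn : sgn (ε 1) = -sgn (ε 0) := by linarith
  -- closedness at the source of the first letter forces the same source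
  have h0 := congrFun hcl (w 0).src
  simp only [boundaryCharge, Fin.sum_univ_two, Pi.zero_apply, if_true,
    if_neg (LEdge.tgt_ne_src (by omega) (w 0)), hsgn] at h0
  have hs0 : sgn (ε 0) ≠ 0 := by rcases sgn_eq_or (ε 0) with h | h <;> simp [h]
  have hsrc : (w 1).src = (w 0).src := by
    by_contra hne
    rw [if_neg hne] at h0
    by_cases ht : (w 1).tgt = (w 0).src
    · rw [if_pos ht] at h0
      exact hs0 (by linarith)
    · rw [if_neg ht] at h0
      exact hs0 (by linarith)
  exact ⟨LEdge.ext_of_src_dir hsrc hdir, hε⟩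

/-- **THE GIRTH LEMMA.**  On a torus of side `L ≥ 4`, a CLOSED signed word of length `m ≤ 3` has
trivial horizontal character: `∏_l r(w_l)^{sgn ε_l} = 1` for every `r`. [folklore] -/
theorem wordChar_eq_one_of_closed (hL : 4 ≤ L) {m : ℕ} (hm : m ≤ 3)
    (w : Fin m → LEdge d L a) (ε : Fin m → Bool) (hcl : boundaryCharge w ε = 0)
    (r : LEdge d L a → Circle) : wordChar w ε r = 1 := by
  have heven := even_of_closed w ε (by omega) hcl
  -- `m ∈ {0, 2}`
  rcases Nat.even_iff.1 heven |> fun h => (show m = 0 ∨ m = 2 by omega) with rfl | rfl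
  · simp [wordChar]
  · obtain ⟨hw, hε⟩ := eq_and_ne_of_closed_two (by omega) w ε hcl
    have hsgn : sgn (ε 1) = -sgn (ε 0) := by
      rcases sgn_eq_or (ε 0) with h | h <;> rcases sgn_eq_or (ε 1) with h' | h' <;>
        simp_all [sgn]
    rw [wordChar, Fin.prod_univ_two, hw, hsgn, zpow_neg, mul_inv_cancel]

end Summit.Ventures.LatticeQCDFlow.Theory2.Lattice.U1Layer

end
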